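import Mathlib.Analysis.Polynomial.Basic
import Mathlib.Algebra.Polynomial.Roots
import Literature.Geometry.Lorentzian.ReggeWheelerChannels

/-!
# Route PhotonSphereChannels — an eternal bounded field that is a kernel element from every apex is
# static on the far strip

Helper file `--supports stmt-FinalStateConjecture-17430` (crux `ChannelsResolveTameDevelopmentsR`, K2R-T2):
the FIRST LEMMA of the crux-ideate round-2 card `channels-to-all-orders`
(`Cruxes/ChannelsResolveTameDevelopmentsR/Ideas/channels-to-all-orders.md`; typed as
`Cruxes/…/SketchIdeator5.lean : Ideator5G1.EternalFarKernelIsStatic`), over the landed Literature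
vocabulary `ReggeWheeler.{exteriorCone, rwKernel, IsPolynomialInTimeOn}`:

* `RW.exists_polynomial_of_locally_polynomial` — a function `f : ℝ → ℝ` which, around EVERY base point
  `B`, agrees on the window `(B − w, B + w)` of FIXED width with some polynomial (degree depending on
  `B`) is globally one polynomial (overlapping windows; two real polynomials agreeing on an open
  interval coincide; chaining along `k · s / n`);
* `RW.eq_const_of_polynomial_bounded` — a polynomial function bounded on `ℝ` is constant
  (`Polynomial.isBoundedUnder_abs_atTop_iff`);
* `RW.eternalFarKernelIsStatic` — the card's statement verbatim: if for every apex time `B` the shifted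
  field `φ(B + ·, ·)` agrees on the far component `{x − xc > ρ + |t|}` of the exterior cone with an
  element of the non-radiative kernel `rwKernel V xc ρ` (solutions polynomial in `t` on the cone), and `φ`
  is bounded on the far strip `{x > xc + ρ} × ℝ_t`, then `φ(t, x) = φ(0, x)` for `x > xc + ρ` (at a far
  point `x` the cone fibres of nearby apexes overlap on windows of width `2(x − xc − ρ)`, so `φ(·, x)` is
  one polynomial in `t` on `ℝ`; bounded polynomials are constant).  This is the step where
  Alexakis–Schlue use time-periodicity; eternity + boundedness replaces it.

No definitions. [folklore]
-/

namespace Summit.FinalStateConjecture.FinalStateConjecture.Theorems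

-- every `Summit.FinalStateConjecture.FinalStateConjecture.…` name repeats the summit = sub-problem
-- segment (D-0017 layout), as in every landed `…Theorems` file of this route
set_option linter.dupNamespace false

open Set Filter Topology Polynomial
open Literature.Geometry.Lorentzian Literature.Geometry.Lorentzian.ReggeWheeler

noncomputable section

namespace RW

/-! ### Locally polynomial with a uniform window ⇒ globally polynomial -/

/-- Two real polynomials that agree on a non-empty open interval are equal. [folklore] -/
theorem polynomial_eq_of_eqOn_Ioo {P Q : ℝ[X]} {a b : ℝ} (hab : a < b)
    (h : ∀ s ∈ Ioo a b, P.eval s = Q.eval s) : P = Q :=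
  Polynomial.eq_of_infinite_eval_eq P Q ((Ioo_infinite hab).mono fun s hs ↦ h s hs)

/-- **Locally polynomial on windows of fixed width ⇒ one polynomial.** If `w > 0` and for every base
point `B` there is a polynomial `P_B` with `f (B + τ) = P_B(τ)` for `|τ| < w`, then `f` is the
evaluation of a single polynomial on all of `ℝ`. [folklore] -/
theorem exists_polynomial_of_locally_polynomial {f : ℝ → ℝ} {w : ℝ} (hw : 0 < w)
    (h : ∀ B : ℝ, ∃ P : ℝ[X], ∀ τ : ℝ, |τ| < w → f (B + τ) = P.eval τ) :
    ∃ P : ℝ[X], ∀ s : ℝ, f s = P.eval s := by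
  choose P hP using h
  -- recentred polynomials `Q B = P_B (X − B)`: `f s = (Q B).eval s` for `|s − B| < w`
  set Q : ℝ → ℝ[X] := fun B ↦ (P B).comp (X - C B) with hQ
  have hQev : ∀ B s : ℝ, |s - B| < w → f s = (Q B).eval s := by
    intro B s hs
    have h1 := hP B (s - B) hs
    rw [show B + (s - B) = s by ring] at h1
    rw [h1, hQ]
    simp [eval_comp]
  -- neighbouring base points carry the same polynomial
  have hstep : ∀ B B' : ℝ, |B' - B| < w → Q B' = Q B := by
    intro B B' hBB'
    rw [abs_lt] at hBB'
    -- the windows overlap on `(max B B' − w, min B B' + w)`, a non-empty open interval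
    have hlt : max B B' - w < min B B' + w := by
      rcases le_total B B' with h | h
      · rw [max_eq_right h, min_eq_left h]; linarith
      · rw [max_eq_left h, min_eq_right h]; linarith
    refine polynomial_eq_of_eqOn_Ioo hlt fun s hs ↦ ?_
    have hs1 : |s - B'| < w := by
      rw [abs_lt]; constructor <;> linarith [hs.1, hs.2, le_max_right B B', min_le_right B B']
    have hs2 : |s - B| < w := by
      rw [abs_lt]; constructor <;> linarith [hs.1, hs.2, le_max_left B B', min_le_left B B']
    rw [← hQev B' s hs1, ← hQev B s hs2]
  -- chain from `0` to any `s` in steps of length `< w`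
  refine ⟨Q 0, fun s ↦ ?_⟩
  obtain ⟨n, hn⟩ : ∃ n : ℕ, |s| / w < n := exists_nat_gt _
  have hn0 : 0 < (n : ℝ) := lt_of_le_of_lt (div_nonneg (abs_nonneg s) hw.le) hn
  have hsmall : |s / n| < w := by
    rw [abs_div, abs_of_pos hn0, div_lt_iff₀ hn0]
    rw [div_lt_iff₀ hw] at hn
    linarith [mul_comm (n : ℝ) w]
  have hchain : ∀ k : ℕ, Q ((k : ℝ) * (s / n)) = Q 0 := by
    intro k
    induction k with
    | zero => simp
    | succ k ih =>
        rw [← ih]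
        refine hstep _ _ ?_
        rw [show ((k + 1 : ℕ) : ℝ) * (s / n) - (k : ℝ) * (s / n) = s / n by push_cast; ring]
        exact hsmall
  have hsn : (n : ℝ) * (s / n) = s := mul_div_cancel₀ s hn0.ne'
  calc f s = (Q s).eval s := hQev s s (by simp [hw])
    _ = (Q ((n : ℝ) * (s / n))).eval s := by rw [hsn]
    _ = (Q 0).eval s := by rw [hchain n]

/-- **A polynomial function bounded on `ℝ` is constant.** [folklore] -/
theorem eq_const_of_polynomial_bounded {P : ℝ[X]} {C₀ : ℝ} (hC : ∀ s : ℝ, |P.eval s| ≤ C₀) (s : ℝ) :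
    P.eval s = P.eval 0 := by
  have hbdd : IsBoundedUnder (· ≤ ·) atTop fun x ↦ |eval x P| := isBoundedUnder_of ⟨C₀, hC⟩
  have hdeg : P.degree ≤ 0 := (Polynomial.isBoundedUnder_abs_atTop_iff P).1 hbdd
  rw [eq_C_of_degree_le_zero hdeg]
  simp

/-- **Locally polynomial on windows of fixed width and bounded ⇒ constant.** [folklore] -/
theorem eq_apply_zero_of_locally_polynomial_of_bounded {f : ℝ → ℝ} {w : ℝ} (hw : 0 < w)
    (h : ∀ B : ℝ, ∃ P : ℝ[X], ∀ τ : ℝ, |τ| < w → f (B + τ) = P.eval τ)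
    {C₀ : ℝ} (hC : ∀ s : ℝ, |f s| ≤ C₀) (s : ℝ) : f s = f 0 := by
  obtain ⟨P, hP⟩ := exists_polynomial_of_locally_polynomial hw h
  rw [hP s, hP 0]
  exact eq_const_of_polynomial_bounded (fun σ ↦ (hP σ) ▸ hC σ) s

/-! ### The card's first lemma -/

/-- **An eternal bounded field that is a kernel element from every apex is static on the far strip** —
the first lemma `Ideator5G1.EternalFarKernelIsStatic` of the crux-ideate card `channels-to-all-orders`
(crux stmt-FinalStateConjecture-17430), verbatim.  Let `V` be a potential, `xc` a centre, `ρ ≥ 0` an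
aperture and `φ : ℝ → ℝ → ℝ` a field such that (a) for EVERY apex time `B` the time-shifted field
`φ(B + ·, ·)` agrees, on the far component `{x − xc > ρ + |t|}` of the exterior cone, with some element
of the non-radiative kernel `rwKernel V xc ρ` (solutions polynomial in `t` on the cone), and (b) `φ` is
bounded on the far strip `{x > xc + ρ} × ℝ_t`.  Then `φ(t, x) = φ(0, x)` for `x > xc + ρ`.  (At a far
point `x` the cone fibres `{|τ| < x − xc − ρ}` of all apexes have the same positive width, so `φ(·, x)`
is locally — hence globally — one polynomial in `t`; bounded polynomials are constant.  `0 ≤ ρ` is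
used only to place `x` on the far side of `xc`; the solution property of kernel elements is not used.)
The periodicity step it replaces: Alexakis–Schlue, JDG 108 (2018), Thm. 1.2 (`AlexakisSchlue2018`). [folklore] -/
theorem eternalFarKernelIsStatic :
    ∀ (V : ℝ → ℝ) (xc ρ : ℝ), 0 ≤ ρ → ∀ φ : ℝ → ℝ → ℝ,
      (∀ B : ℝ, ∃ p ∈ rwKernel V xc ρ, ∀ z ∈ exteriorCone xc ρ, xc < z.2 → φ (B + z.1) z.2 = p z.1 z.2) →
      (∃ C : ℝ, ∀ (t x : ℝ), xc + ρ < x → |φ t x| ≤ C) →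
        ∀ (t x : ℝ), xc + ρ < x → φ t x = φ 0 x := by
  intro V xc ρ hρ φ hker hbdd t x hx
  obtain ⟨C₀, hC⟩ := hbdd
  -- the window width at the far point `x`
  set w : ℝ := x - xc - ρ with hw
  have hw0 : 0 < w := by rw [hw]; linarith
  have hxc : xc < x := by linarith [hρ]
  -- `φ(·, x)` is locally polynomial on windows of width `w`
  have hloc : ∀ B : ℝ, ∃ P : ℝ[X], ∀ τ : ℝ, |τ| < w → (fun σ ↦ φ σ x) (B + τ) = P.eval τ := by
    intro B
    obtain ⟨p, hp, hφp⟩ := hker B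
    obtain ⟨N, a, ha⟩ := hp.2.2
    refine ⟨∑ i ∈ Finset.range N, Polynomial.C (a i x) * X ^ i, fun τ hτ ↦ ?_⟩
    have hz : ((τ, x) : ℝ × ℝ) ∈ exteriorCone xc ρ := by
      rw [mem_exteriorCone]
      show ρ + |τ| < |x - xc|
      rw [abs_of_pos (sub_pos.2 hxc)]
      rw [hw] at hτ
      linarith
    have h1 := hφp (τ, x) hz hxc
    have h2 := ha (τ, x) hz
    simp only at h1 h2
    show φ (B + τ) x = _
    rw [h1, h2, eval_finsetSum]
    simp [eval_pow, eval_X]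
  have hCx : ∀ s : ℝ, |(fun σ ↦ φ σ x) s| ≤ C₀ := fun s ↦ hC s x hx
  exact eq_apply_zero_of_locally_polynomial_of_bounded hw0 hloc hCx t

end RW

end

end Summit.FinalStateConjecture.FinalStateConjecture.Theorems
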